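import Summits.NavierStokesRegularity.NavierStokesRegularity.Theorems.ExtremiserTransienceNearExtremalTransienceExtremiserLiouvilleConstantSpeedKKT
import HarnessLib

/-!
# Crux `ExtremiserTransience.NearExtremalTransience` (stmt-NavierStokesRegularity-21883), line `extremiser_liouville`,
# stub K1b — EULER–LAGRANGE EQUATION OF A CONSTANT-SPEED EXTREMISER IN TANGENTIAL DIRECTIONS

`--supports stmt-NavierStokesRegularity-21883` (helper).  Author: prover seat `ns-el-k1b` (g2).

`ext_firstVariation_eq_zero_of_inner_eq_zero`: for a constant-speed extended extremiser `v` and every smooth compactly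
supported divergence-free `φ` with `⟪v, φ⟫ ≡ 0` (variations TANGENT to the sphere `‖v‖ = M`), the first variation
vanishes: `S·J₁(φ) = κ⋆²M²(W a₁(φ) + Z c₁(φ))` — the KKT inequality (`ext_firstVariation_le_of_sup_inner`, `s = 0`) applied
to `φ` and `−φ`.  This is the Euler–Lagrange system of route (a) in the crux record.

WHAT THIS IS NOT: nothing here proves NS regularity. [folklore]
-/

noncomputable section

open Set Filter Topology MeasureTheory Metric Function
open scoped ENNReal NNReal Topology InnerProductSpace RealInnerProductSpace ContDiff
open Literature.Analysis.FluidPDE Literature.Analysis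

namespace Summit.NavierStokesRegularity.NavierStokesRegularity.Theorems

-- the problem directory repeats the summit name (`NavierStokesRegularity/NavierStokesRegularity`)
set_option linter.dupNamespace false

namespace ExtremiserLiouville

open DepletionLadder.KStar

variable {v φ : EuclideanSpace ℝ (Fin 3) → EuclideanSpace ℝ (Fin 3)}

/-- `curl (−φ) = −curl φ` pointwise. [folklore] -/
theorem curl_neg_apply (φ : EuclideanSpace ℝ (Fin 3) → EuclideanSpace ℝ (Fin 3)) (x : EuclideanSpace ℝ (Fin 3)) :
    curl (fun y => -φ y) x = -curl φ x := by
  rw [curl_eq_curlCLM, curl_eq_curlCLM, fderiv_fun_neg, map_neg]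

/-- `curl (−φ) = −curl φ` as functions. [folklore] -/
theorem curl_neg_eq (φ : EuclideanSpace ℝ (Fin 3) → EuclideanSpace ℝ (Fin 3)) :
    curl (fun y => -φ y) = fun y => -curl φ y := funext (curl_neg_apply φ)

/-- `−φ` is divergence free if `φ` is. [folklore] -/
theorem isDivFree_neg (hφdiv : VectorCalculus.IsDivFree φ) : VectorCalculus.IsDivFree fun y => -φ y := fun x => by
  have h := hφdiv x
  unfold VectorCalculus.divergence at h ⊢
  rw [fderiv_fun_neg, ContinuousLinearMap.toLinearMap_neg, map_neg, h, neg_zero]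

/-- The three first-variation integrals are odd in `φ`. [folklore] -/
theorem firstVariation_integrals_neg (v φ : EuclideanSpace ℝ (Fin 3) → EuclideanSpace ℝ (Fin 3)) :
    (∫ x, (⟪curl (fun y => -φ y) x, fderiv ℝ v x (curl v x)⟫ + ⟪curl v x, fderiv ℝ (fun y => -φ y) x (curl v x)⟫ + ⟪curl v x, fderiv ℝ v x (curl (fun y => -φ y) x)⟫)) =
      -∫ x, (⟪curl φ x, fderiv ℝ v x (curl v x)⟫ + ⟪curl v x, fderiv ℝ φ x (curl v x)⟫ + ⟪curl v x, fderiv ℝ v x (curl φ x)⟫) ∧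
    (∫ x, ⟪curl v x, curl (fun y => -φ y) x⟫) = -∫ x, ⟪curl v x, curl φ x⟫ ∧
    (∫ x, ∑ i, ⟪fderiv ℝ (curl v) x (EuclideanSpace.basisFun (Fin 3) ℝ i), fderiv ℝ (curl (fun y => -φ y)) x (EuclideanSpace.basisFun (Fin 3) ℝ i)⟫) =
      -∫ x, ∑ i, ⟪fderiv ℝ (curl v) x (EuclideanSpace.basisFun (Fin 3) ℝ i), fderiv ℝ (curl φ) x (EuclideanSpace.basisFun (Fin 3) ℝ i)⟫ := by
  refine ⟨?_, ?_, ?_⟩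
  · rw [← integral_neg]
    refine integral_congr_ae (Eventually.of_forall fun x => ?_)
    have hD : fderiv ℝ (fun y => -φ y) x (curl v x) = -(fderiv ℝ φ x (curl v x)) := by
      rw [fderiv_fun_neg]; rfl
    simp only [curl_neg_apply, hD, inner_neg_left, inner_neg_right, map_neg]
    ring
  · rw [← integral_neg]
    refine integral_congr_ae (Eventually.of_forall fun x => ?_)
    simp only [curl_neg_apply, inner_neg_right]
  · rw [← integral_neg]
    refine integral_congr_ae (Eventually.of_forall fun x => ?_)
    have hD : ∀ i, fderiv ℝ (curl (fun y => -φ y)) x (EuclideanSpace.basisFun (Fin 3) ℝ i) =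
        -(fderiv ℝ (curl φ) x (EuclideanSpace.basisFun (Fin 3) ℝ i)) := fun i => by
      rw [curl_neg_eq, fderiv_fun_neg]; rfl
    simp only [hD, inner_neg_right, Finset.sum_neg_distrib]

/-- **Euler–Lagrange equation in tangential directions**: for a constant-speed extended extremiser and a test field
`φ ⊥ v` pointwise, `S·J₁(φ) = κ⋆²M²(W a₁(φ) + Z c₁(φ))`. [folklore] -/
theorem ext_firstVariation_eq_zero_of_inner_eq_zero
    (hv : ContDiff ℝ ∞ v) (hdiv : VectorCalculus.IsDivFree v) {M B : ℝ} (hMpos : 0 < M)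
    (hM : ∀ x, ‖v x‖ = M) (hB : ∀ x, ‖fderiv ℝ v x‖ ≤ B)
    (h1 : ∫⁻ x, ‖iteratedFDeriv ℝ 1 v x‖ₑ ^ 2 < ⊤) (h2 : ∫⁻ x, ‖iteratedFDeriv ℝ 2 v x‖ₑ ^ 2 < ⊤)
    (hatt : |∫ x, ⟪curl v x, fderiv ℝ v x (curl v x)⟫| = (sInf {κ : ℝ | (∀ (v : EuclideanSpace ℝ (Fin 3) → EuclideanSpace ℝ (Fin 3)) (M B : ℝ), ContDiff ℝ (⊤ : ℕ∞) v → Literature.Analysis.FluidPDE.VectorCalculus.IsDivFree v → (∀ x, ‖v x‖ ≤ M) → (∀ x, ‖fderiv ℝ v x‖ ≤ B) → (∫⁻ x, ‖iteratedFDeriv ℝ 0 v x‖ₑ ^ 2 < ⊤) → (∫⁻ x, ‖iteratedFDeriv ℝ 1 v x‖ₑ ^ 2 < ⊤) → (∫⁻ x, ‖iteratedFDeriv ℝ 2 v x‖ₑ ^ 2 < ⊤) → |∫ x, ⟪Literature.Analysis.FluidPDE.curl v x, fderiv ℝ v x (Literature.Analysis.FluidPDE.curl v x)⟫_ℝ|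 ≤ κ * M * Real.sqrt (∫ x, ‖Literature.Analysis.FluidPDE.curl v x‖ ^ 2) * Real.sqrt (∫ x, Literature.Analysis.FluidPDE.frobeniusNormSq (fderiv ℝ (Literature.Analysis.FluidPDE.curl v) x)))}) * M * Real.sqrt (∫ x, ‖curl v x‖ ^ 2) * Real.sqrt (∫ x, frobeniusNormSq (fderiv ℝ (curl v) x)))
    (hφ : ContDiff ℝ ∞ φ) (hφc : HasCompactSupport φ) (hφdiv : VectorCalculus.IsDivFree φ)
    (h0 : ∀ x, ⟪v x, φ x⟫ = 0) :
    (∫ x, ⟪curl v x, fderiv ℝ v x (curl v x)⟫) * (∫ x, (⟪curl φ x, fderiv ℝ v x (curl v x)⟫ + ⟪curl v x, fderiv ℝ φ x (curl v x)⟫ + ⟪curl v x, fderiv ℝ v x (curl φ x)⟫)) =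
      (sInf {κ : ℝ | (∀ (v : EuclideanSpace ℝ (Fin 3) → EuclideanSpace ℝ (Fin 3)) (M B : ℝ), ContDiff ℝ (⊤ : ℕ∞) v → Literature.Analysis.FluidPDE.VectorCalculus.IsDivFree v → (∀ x, ‖v x‖ ≤ M) → (∀ x, ‖fderiv ℝ v x‖ ≤ B) → (∫⁻ x, ‖iteratedFDeriv ℝ 0 v x‖ₑ ^ 2 < ⊤) → (∫⁻ x, ‖iteratedFDeriv ℝ 1 v x‖ₑ ^ 2 < ⊤) → (∫⁻ x, ‖iteratedFDeriv ℝ 2 v x‖ₑ ^ 2 < ⊤) → |∫ x, ⟪Literature.Analysis.FluidPDE.curl v x, fderiv ℝ v x (Literature.Analysis.FluidPDE.curl v x)⟫_ℝ| ≤ κ * M * Real.sqrt (∫ x, ‖Literature.Analysis.FluidPDE.curl v x‖ ^ 2) * Real.sqrt (∫ x, Literature.Analysis.FluidPDE.frobeniusNormSq (fderiv ℝ (Literature.Analysis.FluidPDE.curl v) x)))}) ^ 2 * M ^ 2 * ((∫ x, frobeniusNormSq (fderiv ℝ (curl v) x)) * (∫ x, ⟪curl v x, curl φ x⟫) + (∫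 x, ‖curl v x‖ ^ 2) * (∫ x, ∑ i, ⟪fderiv ℝ (curl v) x (EuclideanSpace.basisFun (Fin 3) ℝ i), fderiv ℝ (curl φ) x (EuclideanSpace.basisFun (Fin 3) ℝ i)⟫)) := by
  have hle := ext_firstVariation_le_of_sup_inner hv hdiv hMpos hM hB h1 h2 hatt hφ hφc hφdiv (s := 0)
    (fun x => (h0 x).le)
  have hle' := ext_firstVariation_le_of_sup_inner hv hdiv hMpos hM hB h1 h2 hatt (hφ.neg) hφc.neg (isDivFree_neg hφdiv)
    (s := 0) (fun x => by rw [inner_neg_right, h0 x, neg_zero])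
  obtain ⟨hJ, hA, hC⟩ := firstVariation_integrals_neg v φ
  rw [hJ, hA, hC] at hle'
  rw [zero_div, zero_mul, zero_mul, zero_add] at hle hle'
  linarith

end ExtremiserLiouville

end Summit.NavierStokesRegularity.NavierStokesRegularity.Theorems

end
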